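import Summits.HodgeConjecture.HodgeConjecture.Theorems.R90S6SatakeGraphPartnerUnique   -- ★ W3-b: `unitaryHeckeEigencharacterAdic_two_aeval`, `exists_generator_unitaryHeckeAlgebraAdic_two`
import HarnessLib

/-!
# R90 · S6 «Ch. 14.1–14.5 stable trace formula» — WAVE 3 card W3-d′: every unramified Hecke eigen-polynomial of `U(J₀,2)(E_w)` is
# SYMMETRIC, i.e. of the form `z ↦ Q(z + z⁻¹)` (`Theorems/R90S6HeckeEigenpolyTwoSymmetric.lean`)

Cell `hodgecm-mathlib`, crux H413 (`stmt-HodgeConjecture-24833`), route of record `HCCMUnconditional`; programme R90-TF, section S6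
(base `R90-C14`), seat R90-C14-p03 (g0); S6 WAVE 3 OPEN CARDS (R90-C14-plan (g0), 16:50:09Z), card W3-d′ of the sheet
`R90/R90-C14-plan/g0/S6_wave3cd_targets.v1.R90-C14-plan-g0.lean` 04e65d4ba36b0ae2 :43–:47 (signature token-identical, `.Wave3` dropped).
Helper lane `--supports stmt-HodgeConjecture-24833 --as helper`; ONE theorem (no definition, no instance, no notation, no named fact, no `sorry`);
imports = ★ `Theorems.R90S6SatakeGraphPartnerUnique` (Theorems → Theorems) + HarnessLib.

THE PRINT [Rogawski1990, §4.5 p. 45; §4.9 Prop. 4.9.1 p. 55 `f^∧(z) = Tr(i_G(χ_z) f)`]; [CartierCorvallis1979, §IV Thm. 4.1] (Satake: `ℋ(G,K) ≅ ℂ[z, z⁻¹]^W`,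
`W = {z ↦ z⁻¹}` in rank one).  WHY (S6 ED. 2b): the Hecke variation behind (14.5.1) instantiates ★ `R90.S6.langlandsDichotomy` ∕ ★
`R90.S6.tsum_eq_integral_of_dense` with the family `{z ↦ λ_{(z,1)}(φH)}_{φH ∈ ℋ₂}`; this card says the family lives in `ℂ[z + z⁻¹]` (so it
is read on the REAL `t = z + z⁻¹` chart of ★ W2-a `polyDense_realChart`).  PROOF: `ℋ₂ = ℂ[T₁]` and `λ_{(z,1)}(P(T₁)) = P(z + z⁻¹)` (★ W3-b
lemmas), so `Q := P`.
HONEST LABEL: local Hecke-algebra bookkeeping; proves no printed global statement.  HC_CM is proved only modulo the 7 printed citations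
(2 remaining named inputs: hLiu418 = stmt-HodgeConjecture-24832, h413 = stmt-HodgeConjecture-24833) until rung 0 closes.
-/

set_option autoImplicit false
-- the mandated namespace repeats the single-problem summit's segment (`HodgeConjecture.HodgeConjecture`)
set_option linter.dupNamespace false

noncomputable section

open NumberField IsDedekindDomain Polynomial
open Literature.NumberTheory.Automorphic Literature.NumberTheory.Automorphic.HermitianLattice Literature.NumberTheory.Automorphic.UnitaryGroup

namespace Summit.HodgeConjecture.HodgeConjecture.R90.S6

variable {F E : Type} [Field F] [NumberField F] [Field E] [NumberField E] [Algebra F E] [Algebra.IsQuadraticExtension F E]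
  (c : E ≃ₐ[F] E) (hc1 : c ≠ 1) (v : HeightOneSpectrum (𝓞 F)) (w : PlacesOver E v) (hw : c • w.1 = w.1)
  (hv : Algebra.IsUnramifiedIn (𝓞 E) v.asIdeal)

/-- **W3-d′ — the unramified Hecke eigen-polynomials of `U(J₀,2)(E_w)` are symmetric** [Rogawski1990, §4.5 p. 45; CartierCorvallis1979 §IV
Thm. 4.1]: for every `φH ∈ ℋ(U(J₀,2)(E_w), K₀)` there is `Q ∈ ℂ[X]` with `λ_{(z,1)}(φH) = Q(z + z⁻¹)` for all `z ∈ ℂˣ` — write `φH = P(T₁)`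
(★ `exists_generator_unitaryHeckeAlgebraAdic_two`) and take `Q := P` (★ `unitaryHeckeEigencharacterAdic_two_aeval`).  (Sheet
`S6_wave3cd_targets.v1` :43–:47 token-for-token.) [cite: Rogawski1990, §4.5 p. 45; §4.9 Prop. 4.9.1 p. 55] [cite: CartierCorvallis1979, §IV Thm. 4.1, Cor. 4.2] -/
theorem hecke_eigenpoly_two_symmetric
    (φH : heckeAlgebra ℂ ↥(unitaryGroupOfForm (galAdicCompletionMap (L := E) c hw) ((StdForm.antidiagonal 2).over (w.1.adicCompletion E)))
      (unitaryInt (galAdicCompletionMap (L := E) c hw) ((StdForm.antidiagonal 2).over (w.1.adicCompletion E)))) :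
    ∃ Q : ℂ[X], ∀ z : ℂˣ, unitaryHeckeEigencharacterAdic c hc1 v w hw hv ![z, 1] φH = Q.eval ((z : ℂ) + (z : ℂ)⁻¹) := by
  obtain ⟨T₁, hT₁, hgen⟩ := exists_generator_unitaryHeckeAlgebraAdic_two c hc1 v w hw hv
  obtain ⟨P, rfl⟩ := hgen φH
  exact ⟨P, fun z => unitaryHeckeEigencharacterAdic_two_aeval c hc1 v w hw hv hT₁ P z⟩

end Summit.HodgeConjecture.HodgeConjecture.R90.S6

end
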